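import Summits.AtomisticToContinuum.BoseEinsteinCondensation.Theses.BECInsertionVariance

/-!
# Birth skeleton (BC3) — crux `GroundStateCondensate` (stmt-AtomisticToContinuum-12067) of
# route-AtomisticToContinuum-BECInsertionVariance

Crux (the route decl, concluded BY NAME below):
`Summit.AtomisticToContinuum.BoseEinsteinCondensation.Theses.BECInsertionVariance.GroundStateCondensate`
— for every repulsive finite-range `v` there is `ρ₀ > 0` such that for `0 < ρ < ρ₀`, eventually in
`n`, `maxOccupation (n+1) Ψ₀ ≤ condensateNumber v (n+1) L`, `L = sideLength ρ (n+1)`,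
`Ψ₀ = groundState v (n+1) L` (THE nonnegative Dirichlet ground state; junk value `0`), where
`condensateNumber = ⨆_{δ>0} ⨅_{trial Ψ, energy Ψ ≤ E₀+δ} maxOccupation Ψ`.

Line = the route's own two-layer plan `GroundStateUnique → SublevelCompact → GroundStateCondensate`
with `SublevelCompact` cut into its two analytic halves, and EXISTENCE of the ground state kept out
of every stub (the junk branch `groundState = 0` is discharged in the assembly, so this crux does
not duplicate the existence work of `GroundStateAccessible`):

* `stub_groundStateUnique` (hardest; the crux's stated risk) — UNIQUENESS UP TO PHASE, eventually:
  for `v` repulsive finite-range, all small `ρ` and all large `N = n+1`, any two ground states of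
  `H_N` on `Λ_L` (`IsGroundState` = normalised minimisers of the closed form) agree a.e. up to a
  constant phase. No existence is claimed (vacuous when there is no ground state). Finite `v`:
  positivity-improving `e^{-tH}` / Perron–Frobenius (Reed–Simon IV Thms XIII.44–47; in tree for
  bounded `v` on the Feynman–Kac side); hard cores / `⊤`-shells: energetic dominance of the fluid
  component of the accessible region at low density (Reed–Simon XIII.48(b) is the warning).
* `stub_nearMinimisers_tendstoL2` — COMPACTNESS OF NEAR-MINIMISERS modulo phase: under
  `HasUniqueGroundState v N L`, a sequence of trial states with `energy ≤ E₀ + δ_k`, `δ_k → 0`, has a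
  subsequence converging in `L²` to `c • Ψ₀`, `|c| = 1` (Rellich–Kondrachov on the bounded box
  `Λ_L^N` — `Literature.Analysis.FunctionSpaces…rellich_kondrachov_holds` is in tree —, closedness
  `IsGroundState.of_tendstoL2` after choosing a Dirichlet/symmetric representative, uniqueness, and
  insensitivity of `TendstoL2` to an a.e. change of the limit).
* `stub_maxOccupation_lsc` — `λ_max(γ_Ψ) = maxOccupation` IS `L²`-LOWER-SEMICONTINUOUS along trial
  states and blind to a constant phase: `TendstoL2 Θ (c • Ψ)`, `|c| = 1`, `Ψ` measurable ⇒
  `maxOccupation N Ψ ≤ liminf_k maxOccupation N (Θ k)` (each `⟨φ, γ_Θ φ⟩` is `N ×` the square of an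
  `L²`-contraction `Θ ↦ ⟨φ, Θ(·, Y)⟩`, hence continuous; a sup of continuous functions is lsc).

Assembly `GroundStateCondensate_of` (real proof, `maxOccupation_le_condensateNumber_of`): fix `v`,
take `ρ₀` from the uniqueness stub; eventually in `n`: if no nonnegative ground state exists then
`groundState = 0` and `maxOccupation (n+1) 0 = 0`; otherwise `HasUniqueGroundState` holds, and if
`condensateNumber < maxOccupation Ψ₀` pick `m'` strictly between, for every `k` a `k⁻¹`-near-
minimiser `Ψ_k` with `maxOccupation Ψ_k < m'` (definition of `⨆ δ ⨅`), pass to the `L²`-convergent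
subsequence (compactness stub) and contradict lower semicontinuity (lsc stub).
-/

namespace Summit.AtomisticToContinuum.BoseEinsteinCondensation.Cruxes.GroundStateCondensate.Birth

open MeasureTheory Filter
open scoped ENNReal Topology

/-! ### Registered stubs (the ONLY `sorry`s of this file) -/

/-- Stub U (L–XL, HARDEST — the crux's recorded risk): uniqueness of the ground state up to phase, eventually in
`N` at small density; NO existence claimed. For repulsive finite-range `v`, all sufficiently small densities `ρ`
and all large `N = n+1`, any two ground states of `H_N` in the Dirichlet box of side `(N/ρ)^{1/3}` agree a.e. up
to a constant phase. -/
theorem stub_groundStateUnique :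
    ∀ v : ℝ → ENNReal, Literature.MathematicalPhysics.QuantumManyBody.BoseGas.IsRepulsiveFiniteRange v →
      ∃ ρ₀ : ℝ, 0 < ρ₀ ∧ ∀ ρ : ℝ, 0 < ρ → ρ < ρ₀ → ∀ᶠ n : ℕ in Filter.atTop,
        ∀ Ψ Φ : Literature.MathematicalPhysics.QuantumManyBody.BoseGas.Config (n + 1) → ℂ,
          Literature.MathematicalPhysics.QuantumManyBody.BoseGas.IsGroundState v
              (Literature.MathematicalPhysics.QuantumManyBody.BoseGas.sideLength ρ (n + 1)) Ψ →
          Literature.MathematicalPhysics.QuantumManyBody.BoseGas.IsGroundState v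
              (Literature.MathematicalPhysics.QuantumManyBody.BoseGas.sideLength ρ (n + 1)) Φ →
            ∃ c : ℂ, ‖c‖ = 1 ∧
              ∀ᵐ X : Literature.MathematicalPhysics.QuantumManyBody.BoseGas.Config (n + 1),
                Φ X = c * Ψ X := by
  sorry

/-- Stub C (L): compactness of near-minimisers modulo phase at fixed `N, L` — under nondegeneracy, every sequence
of admissible trial states whose energies are within `δ_k → 0` of `E₀(N, L)` has a subsequence converging in `L²`
to a constant phase times THE nonnegative ground state (Rellich–Kondrachov on `Λ_L^N`, closedness
`IsGroundState.of_tendstoL2`, uniqueness). -/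
theorem stub_nearMinimisers_tendstoL2 :
    ∀ (v : ℝ → ENNReal) (N : ℕ) (L : ℝ),
      Literature.MathematicalPhysics.QuantumManyBody.BoseGas.IsRepulsiveFiniteRange v →
      Literature.MathematicalPhysics.QuantumManyBody.BoseGas.HasUniqueGroundState v N L →
        ∀ (Ψ : ℕ → Literature.MathematicalPhysics.QuantumManyBody.BoseGas.TrialState N L)
          (δ : ℕ → ENNReal),
          (∀ k, Literature.MathematicalPhysics.QuantumManyBody.BoseGas.energy v (Ψ k) ≤
              Literature.MathematicalPhysics.QuantumManyBody.BoseGas.groundStateEnergy v N L + δ k) →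
          Filter.Tendsto δ Filter.atTop (nhds 0) →
            ∃ φ : ℕ → ℕ, StrictMono φ ∧ ∃ c : ℂ, ‖c‖ = 1 ∧
              Literature.MathematicalPhysics.QuantumManyBody.BoseGas.TendstoL2 (fun k => Ψ (φ k))
                (fun X => c *
                  (Literature.MathematicalPhysics.QuantumManyBody.BoseGas.groundState v N L X : ℂ)) := by
  sorry

/-- Stub S (M–L): lower semicontinuity of `λ_max = maxOccupation` along trial states, modulo phase, at fixed
`N, L` — if trial states `Θ_k` converge in `L²` to `c • Ψ` with `|c| = 1` and `Ψ` measurable, then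
`maxOccupation N Ψ ≤ liminf_k maxOccupation N Θ_k`. -/
theorem stub_maxOccupation_lsc :
    ∀ (N : ℕ) (L : ℝ) (Θ : ℕ → Literature.MathematicalPhysics.QuantumManyBody.BoseGas.TrialState N L)
      (Ψ : Literature.MathematicalPhysics.QuantumManyBody.BoseGas.Config N → ℂ) (c : ℂ),
      Measurable Ψ → ‖c‖ = 1 →
      Literature.MathematicalPhysics.QuantumManyBody.BoseGas.TendstoL2 Θ (fun X => c * Ψ X) →
        Literature.MathematicalPhysics.QuantumManyBody.BoseGas.maxOccupation N Ψ ≤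
          Filter.liminf (fun k =>
            Literature.MathematicalPhysics.QuantumManyBody.BoseGas.maxOccupation N (Θ k).ψ)
            Filter.atTop := by
  sorry

/-! ### Audit names of the stub statements

`Goal.stub_x : Prop` is VERBATIM the statement of the registered stub `stub_x` above, so that the skeleton audit
(`#h21_check_skeleton`, by-name policy on hypothesis heads) reads the hypotheses of `GroundStateCondensate_of` as
exactly the three declared stubs; `GroundStateCondensate_proof` below is the kernel-checked guard that the two
copies agree. (The `@[stub]` tag is gate-reserved, hence plain `abbrev`s, as in the accepted
`Cruxes/DensityResponse/Lines/force-balance-constitutive.lean`.) -/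

namespace Goal

/-- Statement of stub U `stub_groundStateUnique`. -/
abbrev stub_groundStateUnique : Prop :=
    ∀ v : ℝ → ENNReal, Literature.MathematicalPhysics.QuantumManyBody.BoseGas.IsRepulsiveFiniteRange v →
      ∃ ρ₀ : ℝ, 0 < ρ₀ ∧ ∀ ρ : ℝ, 0 < ρ → ρ < ρ₀ → ∀ᶠ n : ℕ in Filter.atTop,
        ∀ Ψ Φ : Literature.MathematicalPhysics.QuantumManyBody.BoseGas.Config (n + 1) → ℂ,
          Literature.MathematicalPhysics.QuantumManyBody.BoseGas.IsGroundState v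
              (Literature.MathematicalPhysics.QuantumManyBody.BoseGas.sideLength ρ (n + 1)) Ψ →
          Literature.MathematicalPhysics.QuantumManyBody.BoseGas.IsGroundState v
              (Literature.MathematicalPhysics.QuantumManyBody.BoseGas.sideLength ρ (n + 1)) Φ →
            ∃ c : ℂ, ‖c‖ = 1 ∧
              ∀ᵐ X : Literature.MathematicalPhysics.QuantumManyBody.BoseGas.Config (n + 1),
                Φ X = c * Ψ X

/-- Statement of stub C `stub_nearMinimisers_tendstoL2`. -/
abbrev stub_nearMinimisers_tendstoL2 : Prop :=
    ∀ (v : ℝ → ENNReal) (N : ℕ) (L : ℝ),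
      Literature.MathematicalPhysics.QuantumManyBody.BoseGas.IsRepulsiveFiniteRange v →
      Literature.MathematicalPhysics.QuantumManyBody.BoseGas.HasUniqueGroundState v N L →
        ∀ (Ψ : ℕ → Literature.MathematicalPhysics.QuantumManyBody.BoseGas.TrialState N L)
          (δ : ℕ → ENNReal),
          (∀ k, Literature.MathematicalPhysics.QuantumManyBody.BoseGas.energy v (Ψ k) ≤
              Literature.MathematicalPhysics.QuantumManyBody.BoseGas.groundStateEnergy v N L + δ k) →
          Filter.Tendsto δ Filter.atTop (nhds 0) →
            ∃ φ : ℕ → ℕ, StrictMono φ ∧ ∃ c : ℂ, ‖c‖ = 1 ∧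
              Literature.MathematicalPhysics.QuantumManyBody.BoseGas.TendstoL2 (fun k => Ψ (φ k))
                (fun X => c *
                  (Literature.MathematicalPhysics.QuantumManyBody.BoseGas.groundState v N L X : ℂ))

/-- Statement of stub S `stub_maxOccupation_lsc`. -/
abbrev stub_maxOccupation_lsc : Prop :=
    ∀ (N : ℕ) (L : ℝ) (Θ : ℕ → Literature.MathematicalPhysics.QuantumManyBody.BoseGas.TrialState N L)
      (Ψ : Literature.MathematicalPhysics.QuantumManyBody.BoseGas.Config N → ℂ) (c : ℂ),
      Measurable Ψ → ‖c‖ = 1 →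
      Literature.MathematicalPhysics.QuantumManyBody.BoseGas.TendstoL2 Θ (fun X => c * Ψ X) →
        Literature.MathematicalPhysics.QuantumManyBody.BoseGas.maxOccupation N Ψ ≤
          Filter.liminf (fun k =>
            Literature.MathematicalPhysics.QuantumManyBody.BoseGas.maxOccupation N (Θ k).ψ)
            Filter.atTop

end Goal

/-! ### Proved glue (no `sorry` below this line) -/

section Glue

open Literature.MathematicalPhysics.QuantumManyBody.BoseGas

/-- The zero wave function occupies no mode: `⟨φ, γ_0 φ⟩ = 0`. -/
theorem occupation_zero (N : ℕ) (φ : Space → ℂ) : occupation N φ (fun _ => 0) = 0 := by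
  cases N with
  | zero => simp [occupation]
  | succ n => simp [occupation]

/-- `λ_max(γ_0) = 0` (the junk branch of `groundState`). -/
theorem maxOccupation_zero (N : ℕ) :
    maxOccupation N (fun _ => (0 : ℂ)) = 0 := by
  refine le_antisymm ?_ bot_le
  unfold maxOccupation
  exact iSup₂_le fun φ _ => (occupation_zero N φ).le

/-- The `⨆ δ ⨅`-argument at fixed `N, L`: compactness of near-minimisers modulo phase towards `Ψ₀`
plus lower semicontinuity of `maxOccupation` along trial states converging to a phase multiple of
`Ψ₀` give `λ_max(γ_{Ψ₀}) ≤ condensateNumber v N L`. -/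
theorem maxOccupation_le_condensateNumber_of {v : ℝ → ℝ≥0∞} {N : ℕ} {L : ℝ}
    (Ψ₀ : Config N → ℂ)
    (hC : ∀ (Ψ : ℕ → TrialState N L) (δ : ℕ → ℝ≥0∞),
      (∀ k, energy v (Ψ k) ≤ groundStateEnergy v N L + δ k) → Tendsto δ atTop (𝓝 0) →
        ∃ φ : ℕ → ℕ, StrictMono φ ∧ ∃ c : ℂ, ‖c‖ = 1 ∧
          TendstoL2 (fun k => Ψ (φ k)) (fun X => c * Ψ₀ X))
    (hS : ∀ (Θ : ℕ → TrialState N L) (c : ℂ), ‖c‖ = 1 →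
      TendstoL2 Θ (fun X => c * Ψ₀ X) →
        maxOccupation N Ψ₀ ≤ liminf (fun k => maxOccupation N (Θ k).ψ) atTop) :
    maxOccupation N Ψ₀ ≤ condensateNumber v N L := by
  by_contra hlt
  obtain ⟨m', hm'₁, hm'₂⟩ := exists_between (not_le.1 hlt)
  -- for every `k`, a `k⁻¹`-near-minimiser whose largest occupation is below `m'`
  have key : ∀ k : ℕ, ∃ Ψ : TrialState N L,
      energy v Ψ ≤ groundStateEnergy v N L + (k : ℝ≥0∞)⁻¹ ∧ maxOccupation N Ψ.ψ < m' := by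
    intro k
    have hδ : (0 : ℝ≥0∞) < (k : ℝ≥0∞)⁻¹ := ENNReal.inv_pos.2 (ENNReal.natCast_ne_top k)
    have hle : (⨅ (Ψ : TrialState N L)
        (_ : energy v Ψ ≤ groundStateEnergy v N L + (k : ℝ≥0∞)⁻¹), maxOccupation N Ψ.ψ) ≤
        condensateNumber v N L :=
      le_iSup₂_of_le (f := fun (δ : ℝ≥0∞) (_ : 0 < δ) => ⨅ (Ψ : TrialState N L)
        (_ : energy v Ψ ≤ groundStateEnergy v N L + δ), maxOccupation N Ψ.ψ) _ hδ le_rfl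
    obtain ⟨Ψ, hΨ⟩ := iInf_lt_iff.1 (hle.trans_lt hm'₁)
    obtain ⟨hΨE, hΨm⟩ := iInf_lt_iff.1 hΨ
    exact ⟨Ψ, hΨE, hΨm⟩
  choose Ψ hΨE hΨm using key
  obtain ⟨φ, -, c, hc, hT⟩ :=
    hC Ψ (fun k => (k : ℝ≥0∞)⁻¹) hΨE ENNReal.tendsto_inv_nat_nhds_zero
  have h₁ : maxOccupation N Ψ₀ ≤ liminf (fun k => maxOccupation N (Ψ (φ k)).ψ) atTop :=
    hS (fun k => Ψ (φ k)) c hc hT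
  have h₂ : liminf (fun k => maxOccupation N (Ψ (φ k)).ψ) atTop ≤ m' :=
    liminf_le_of_frequently_le' (Frequently.of_forall fun k => (hΨm (φ k)).le)
  exact lt_irrefl _ ((h₁.trans h₂).trans_lt hm'₂)

end Glue

/-! ### The assembly: stubs ⟹ the crux, by name -/

open Literature.MathematicalPhysics.QuantumManyBody.BoseGas in
/-- **The composition** `stub_groundStateUnique → stub_nearMinimisers_tendstoL2 → stub_maxOccupation_lsc →
GroundStateCondensate` (the route decl, BY NAME; hypotheses by their audit names `Goal.stub_*`, verbatim the stub
statements). Fix `v`, take `ρ₀` from U; eventually in `n`: with a nonnegative ground state,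
`HasUniqueGroundState = ⟨existence, U⟩` feeds C, and `maxOccupation_le_condensateNumber_of` (C + S) gives the
bound; without one, `groundState = 0` and `maxOccupation (n+1) 0 = 0`. -/
theorem GroundStateCondensate_of :
    Goal.stub_groundStateUnique → Goal.stub_nearMinimisers_tendstoL2 → Goal.stub_maxOccupation_lsc →
      Summit.AtomisticToContinuum.BoseEinsteinCondensation.Theses.BECInsertionVariance.GroundStateCondensate := by
  intro hU hC hS v hv
  obtain ⟨ρ₀, hρ₀, hev⟩ := hU v hv
  refine ⟨ρ₀, hρ₀, fun ρ hρ hρ₁ => ?_⟩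
  filter_upwards [hev ρ hρ hρ₁] with n hn
  by_cases hex : ∃ Ψ₀ : Config (n + 1) → ℝ, (∀ X, 0 ≤ Ψ₀ X) ∧
      IsGroundState v (sideLength ρ (n + 1)) (fun X => (Ψ₀ X : ℂ))
  · -- honest branch: existence (`hex`) + uniqueness (`hn`) is `HasUniqueGroundState`
    have hUq : HasUniqueGroundState v (n + 1) (sideLength ρ (n + 1)) := ⟨hex, hn⟩
    have hmeas : Measurable (fun X => (groundState v (n + 1) (sideLength ρ (n + 1)) X : ℂ)) :=
      Complex.measurable_ofReal.comp (measurable_groundState v (n + 1) (sideLength ρ (n + 1)))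
    exact maxOccupation_le_condensateNumber_of
      (fun X => (groundState v (n + 1) (sideLength ρ (n + 1)) X : ℂ))
      (hC v (n + 1) (sideLength ρ (n + 1)) hv hUq)
      (fun Θ c hc hT => hS (n + 1) (sideLength ρ (n + 1)) Θ
        (fun X => (groundState v (n + 1) (sideLength ρ (n + 1)) X : ℂ)) c hmeas hc hT)
  · -- junk branch: `groundState = 0` and `λ_max(γ_0) = 0`
    have h0 : (fun X => (groundState v (n + 1) (sideLength ρ (n + 1)) X : ℂ)) = fun _ => (0 : ℂ) := by
      funext X
      simp [groundState_of_not_exists hex]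
    rw [h0, maxOccupation_zero]
    exact bot_le

/-- The skeleton as a (sorried-through-the-stubs) proof of the crux (D-0027 §3.3 shape): `_of` applied to the
three `stub_*` theorems — also the guard that their verbatim types are the `Goal.stub_*` statements. -/
theorem GroundStateCondensate_proof :
    Summit.AtomisticToContinuum.BoseEinsteinCondensation.Theses.BECInsertionVariance.GroundStateCondensate :=
  GroundStateCondensate_of stub_groundStateUnique stub_nearMinimisers_tendstoL2 stub_maxOccupation_lsc

end Summit.AtomisticToContinuum.BoseEinsteinCondensation.Cruxes.GroundStateCondensate.Birth
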